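import Mathlib.Data.Fintype.BigOperators
import Mathlib.Data.Fintype.Perm
import Mathlib.Tactic.Ring
import Literature.Computability.AlgebraicComplexity.SimultaneousDoubleProduct
import HarnessLib

/-!
# CKSU 2005, Prop. 4.6: the packing limitation `α + 2 ≤ 2β` for SDPP pairs

Topic `Literature/Computability/AlgebraicComplexity`; companion of `SimultaneousDoubleProduct.lean`
(`IsSDPP`, Cohn–Kleinberg–Szegedy–Umans 2005, §4, Def. 4.1), whose docstring lists "the second
inequality `α + 2 ≤ 2β` of Prop. 4.6" as not yet vendored (the first, `α ≤ β`, is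
`IsSDPP.card_mul_card_le` there). Source: H. Cohn, R. Kleinberg, B. Szegedy, C. Umans,
*Group-theoretic algorithms for matrix multiplication*, FOCS 2005, §4, Proposition 4.6
(= "Proposition 25" of the arXiv text math/0511460, held as `paper:arxiv-math_0511460`, chunk p0008
L82–118), read this session:

"**Proposition 4.6.** If `n` pairs of subsets `Aᵢ, Bᵢ ⊆ H` satisfy the simultaneous double product
property, with `|Aᵢ||Bᵢ| ≥ n^α` for all `i` and `|H| = n^β`, then `α ≤ β` and `α + 2 ≤ 2β`. …
*Proof.* … For the other inequality, first note that `A₁, …, Aₙ` are disjoint … Similarly,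
`B₁, …, Bₙ` are also disjoint. It follows that the map
`Sym_n × Sym_n × ∏ᵢ Aᵢ × ∏ᵢ Bᵢ → (Hⁿ)²` defined by `(π, ρ, a, b) ↦ (πa, ρb)` is injective. Here,
the group `Sym_n` acts by permuting the `n` coordinates. Comparing the sizes of these sets yields
`(n!)² (n^α)ⁿ ≤ (n^β)^{2n}`, which implies `2β ≥ α + 2` as `n → ∞`."

This is the printed LIMITATION of the two-families method (with Thm. 4.4, `ω ≤ (3β−2)/α` for abelian
`H`, "the only way to achieve `ω = 2` is `α = β = 2`"), in its finite form.

## Formalisation (theorems only, 0 named facts)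

* `factorial_mul_prod_card_le_of_pairwise_disjoint` — the counting step: for pairwise disjoint
  `A₀, …, A_{n−1} ⊆ H`, the map `(π, a) ↦ (j ↦ a_{π⁻¹ j})` from `Sym_n × ∏ᵢ Aᵢ` to `Hⁿ` is injective,
  so `n! · ∏ᵢ |Aᵢ| ≤ |H|ⁿ`.
* `IsSDPP.factorial_mul_prod_card_left_le` / `…_right_le` — for an SDPP family with non-empty sets,
  `n! ∏ |Aᵢ| ≤ |H|ⁿ` and `n! ∏ |Bᵢ| ≤ |H|ⁿ` (disjointness = the tree's
  `disjoint_left_of_simultaneous` / `disjoint_right_of_simultaneous`).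
* `CohnKleinbergSzegedyUmans2005_prop25` — **the displayed inequality `(n!)² ∏ᵢ |Aᵢ||Bᵢ| ≤ |H|^{2n}`**
  (printed with `|Aᵢ||Bᵢ| ≥ n^α`, `|H| = n^β` as `(n!)²(n^α)ⁿ ≤ (n^β)^{2n}`). The asymptotic reading
  `α + 2 ≤ 2β` (via `n! ≥ (n/e)ⁿ` and direct powers, Lemma 4.2 = the tree's `IsSDPP.piPow`) is not
  restated.
-/

namespace Literature.Computability.AlgebraicComplexity

open Finset

variable {H : Type*} [AddCommGroup H] {n : ℕ}

/-- **The counting step of CKSU Prop. 4.6**: for pairwise disjoint finite sets `A₀, …, A_{n−1}` in a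
finite type `H`, "the map `Sym_n × ∏ᵢ Aᵢ → Hⁿ`, `(π, a) ↦ πa` [`(πa)_j = a_{π⁻¹ j}`] is injective"
(an entry determines the index of the set it comes from), hence `n! · ∏ᵢ |Aᵢ| ≤ |H|ⁿ`.
[cite: CohnKleinbergSzegedyUmans2005, Prop. 4.6 (arXiv Prop. 25), proof] -/
theorem factorial_mul_prod_card_le_of_pairwise_disjoint {H : Type*} [Fintype H] {n : ℕ}
    (A : Fin n → Finset H) (hdisj : ∀ i j : Fin n, i ≠ j → Disjoint (A i) (A j)) :
    n.factorial * ∏ i, (A i).card ≤ Fintype.card H ^ n := by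
  classical
  -- the map `(π, a) ↦ (j ↦ a (π⁻¹ j))`
  let F : Equiv.Perm (Fin n) × (∀ i : Fin n, A i) → (Fin n → H) :=
    fun p j => (p.2 (p.1.symm j) : H)
  have hF : Function.Injective F := by
    rintro ⟨π, a⟩ ⟨σ, b⟩ h
    have hj : ∀ j, (a (π.symm j) : H) = b (σ.symm j) := fun j => congrFun h j
    -- the permutations agree: an entry determines its set
    have hπσ : π = σ := by
      have hsymm : π.symm = σ.symm := by
        ext j
        by_contra hne
        have hd := hdisj _ _ (fun e => hne (congrArg Fin.val e))
        exact Finset.disjoint_left.mp hd (a (π.symm j)).2 (hj j ▸ (b (σ.symm j)).2)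
      simpa using congrArg Equiv.symm hsymm
    subst hπσ
    have hab : a = b := by
      funext i
      apply Subtype.ext
      have := hj (π i)
      rwa [Equiv.symm_apply_apply] at this
    subst hab
    rfl
  have hcard := Fintype.card_le_of_injective F hF
  simpa only [Fintype.card_prod, Fintype.card_perm, Fintype.card_pi, Fintype.card_coe,
    Finset.prod_const, Finset.card_univ, Fintype.card_fin] using hcard

namespace IsSDPP

variable {A B : Fin n → Finset H}

/-- In an SDPP family with all `Bᵢ` non-empty the `Aᵢ` are pairwise disjoint, so
`n! · ∏ᵢ |Aᵢ| ≤ |H|ⁿ` ("`(π, a) ↦ πa` is injective").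
[cite: CohnKleinbergSzegedyUmans2005, Prop. 4.6 (arXiv Prop. 25), proof] -/
theorem factorial_mul_prod_card_left_le [Fintype H] (h : IsSDPP A B)
    (hB : ∀ i : Fin n, (B i).Nonempty) : n.factorial * ∏ i, (A i).card ≤ Fintype.card H ^ n :=
  factorial_mul_prod_card_le_of_pairwise_disjoint A
    fun _ j hij => disjoint_left_of_simultaneous h.2 hij (hB j)

/-- In an SDPP family with all `Aᵢ` non-empty the `Bᵢ` are pairwise disjoint, so
`n! · ∏ᵢ |Bᵢ| ≤ |H|ⁿ` ("`(ρ, b) ↦ ρb` is injective").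
[cite: CohnKleinbergSzegedyUmans2005, Prop. 4.6 (arXiv Prop. 25), proof] -/
theorem factorial_mul_prod_card_right_le [Fintype H] (h : IsSDPP A B)
    (hA : ∀ i : Fin n, (A i).Nonempty) : n.factorial * ∏ i, (B i).card ≤ Fintype.card H ^ n :=
  factorial_mul_prod_card_le_of_pairwise_disjoint B
    fun i _ hij => disjoint_right_of_simultaneous h.2 hij (hA i)

end IsSDPP

/-- **Cohn–Kleinberg–Szegedy–Umans 2005, Proposition 4.6 (arXiv Prop. 25), second inequality — the
packing limitation of the two-families method:** if `n` pairs `(Aᵢ, Bᵢ)` of non-empty subsets of a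
finite abelian group `H` satisfy the simultaneous double product property, then "the map
`Sym_n × Sym_n × ∏ Aᵢ × ∏ Bᵢ → (Hⁿ)²`, `(π, ρ, a, b) ↦ (πa, ρb)` is injective", i.e.
`(n!)² · ∏ᵢ |Aᵢ||Bᵢ| ≤ |H|^{2n}` (printed as `(n!)²(n^α)ⁿ ≤ (n^β)^{2n}`, "which implies `2β ≥ α + 2` as
`n → ∞`"). [cite: CohnKleinbergSzegedyUmans2005, Prop. 4.6 (arXiv Prop. 25)] -/
theorem CohnKleinbergSzegedyUmans2005_prop25 [Fintype H] {A B : Fin n → Finset H} (h : IsSDPP A B)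
    (hne : ∀ i : Fin n, (A i).Nonempty ∧ (B i).Nonempty) :
    n.factorial ^ 2 * ∏ i, ((A i).card * (B i).card) ≤ Fintype.card H ^ (2 * n) := by
  have h₁ := h.factorial_mul_prod_card_left_le fun i => (hne i).2
  have h₂ := h.factorial_mul_prod_card_right_le fun i => (hne i).1
  calc n.factorial ^ 2 * ∏ i, ((A i).card * (B i).card)
      = (n.factorial * ∏ i, (A i).card) * (n.factorial * ∏ i, (B i).card) := by
        rw [Finset.prod_mul_distrib]; ring
    _ ≤ Fintype.card H ^ n * Fintype.card H ^ n := Nat.mul_le_mul h₁ h₂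
    _ = Fintype.card H ^ (2 * n) := by ring

end Literature.Computability.AlgebraicComplexity
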